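import Summits.BirchSwinnertonDyer.BirchSwinnertonDyer.Theorems.SignedLowerHalvesKobayashiLowerHalfLargeImageMuFloorSupply
import Summits.BirchSwinnertonDyer.Rank1Residual.X11a.MuLambdaSplit
import HarnessLib

/-!
# Route `SignedLowerHalves`, crux 3 `KobayashiLowerHalfLargeImage` (item stmt-BirchSwinnertonDyer-19001):
# the μ-PART of Kobayashi's signed main conjecture at large image, part A (algebra + `min(μ(L⁺), μ(L⁻)) = 0`):
# common divisors of Pollack's pair have unit content — NO image hypothesis; stub S2 of line `commonzero_squeeze`
# REDUCED to its unit-content version (cell `bsd-ssimc`, width seat `bsd-line-slh-p1-w6` gen 0; `--supports 19001`)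

HONEST FRAMING.  The crux (the Eisenstein half of Kobayashi's signed main conjecture on the X7 large-image class) is
OPEN and nothing here proves it; BSD is not proved by any of this.  THEOREMS ONLY; no definition.

* §1 `Λ`-algebra (`μ`, `λ` of an element of `Λ` are the tree's `X1.MuLambda.mu` / `lam`; `μ = 0 ⟺ unit content` is the
  tree's `X11a.mu_eq_zero_of_hasUnitContent` / `hasUnitContent_of_mu_eq_zero`): `hasUnitContent_of_dvd`,
  `mu_eq_and_lam_eq_of_span_eq`,
  `mu_eq_and_lam_add_eq_of_span_mul_eq_span` (`(ξ·δ) = (L)`, `μ(δ) = 0` ⟹ `μ(ξ) = μ(L)`, `λ(ξ) + λ(δ) = λ(L)`),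
  `span_eq_iff_lam_eq_of_span_mul_eq_span`.
* §2 **`min(μ(L_p⁺), μ(L_p⁻)) = 0` with NO image hypothesis**: every common divisor of a Pollack pair of the newform
  of a curve with good reduction at `p` and `a_p = 0` has unit content — INPUT-FREE at `p = 3` (THEOREM B on
  Vaserstein's theorem, via `LargeImageMuFloor`, p647857 / slh-p3 p643729), at odd `p` GRANTED Conjecture B⁰
  `TeichSpanGenAll` (used only at `p ≥ 5`): `hasUnitContent_of_dvd_of_dvd[_three]`, `not_C_dvd_and_C_dvd`,
  `mu_eq_zero_or_mu_eq_zero`.  The card of line `commonzero_squeeze` says «no THEOREM B — `min(μ⁺, μ⁻) = 0` is not a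
  theorem at large image and sits inside `stub_commonDivisorsCyclotomic`»: the tree's THEOREM B
  (`EvenBranch.cycWindingNonConstantAt_of_odd`) has NO image hypothesis, so that μ-content IS a theorem at `p = 3`
  (B⁰ at `p ≥ 5`), and **S2 reduces to common divisors WITH unit content** (`commonDivisorsCyclotomic_of_unitContent`:
  the registered-shape body with the line's `cycPhi` passed as a parameter, from the same body restricted to `μ(d) = 0`).
Part B (`…LargeImageMuPart.lean`) multiplies this with the sign-blind Kato defect (S1, w2 g3) to get `μ(X^ε) = μ(L_p^ε)`
for both signs.  CALIBRATION / SUPPORT ONLY (pen rule D34-4 (3)).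

References: [GreenbergVatsal2000] p. 2 (1)–(2), p. 4; [Washington1997] §7.1; [KuriharaPollack2007] §3.2 Problem 3.2,
Prop. 3.3; [PollackWeston2011] Thm. 4.1 (1), Rem. 4.2; [Vaserstein1972SL2] Theorem; [Kobayashi2003] Thm. 3.2 (p. 7).
-/

-- D-0017: single-problem summit, the namespace repeats the problem name by design.
set_option linter.dupNamespace false
set_option autoImplicit false

noncomputable section

open scoped Classical MatrixGroups ModularForm

open CongruenceSubgroup WeierstrassCurve Literature.NumberTheory.EllipticCurves
  Literature.NumberTheory.EllipticCurves.ModularForms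
  Literature.NumberTheory.EllipticCurves.Kobayashi2003 Literature.NumberTheory.EllipticCurves.GreenbergVatsal2000
  Literature.NumberTheory.EllipticCurves.Rank1Residual
  Summit.BirchSwinnertonDyer.Rank1Residual.Supersingular

namespace Summit.BirchSwinnertonDyer.BirchSwinnertonDyer.Theorems.LargeImageMuPart

open Summit.BirchSwinnertonDyer.Rank1Residual.X1.MuLambda
  (mu lam mu_mul lam_mul le_mu_of_C_pow_dvd C_pow_mu_dvd isUnit_iff_mu_eq_zero_and_lam_eq_zero)
open Summit.BirchSwinnertonDyer.BirchSwinnertonDyer.Cruxes.AnalyticMuZeroX9.TeichSpan (TeichSpanGenAll)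
open Summit.BirchSwinnertonDyer.BirchSwinnertonDyer.Theorems.LargeImageMuFloor
  (exists_sign_hasUnitContent_kobayashiL_three)
open Summit.BirchSwinnertonDyer.Rank1Residual.X11a
  (ne_zero_of_hasUnitContent mu_eq_zero_of_hasUnitContent hasUnitContent_of_mu_eq_zero)

/-! ## §1 `Λ`-algebra: unit content vs. `μ`, and `μ` across `(ξ·δ) = (L)` -/

section Algebra

variable {p : ℕ} [Fact p.Prime]

/-- A divisor of an element of `Λ` with unit content has unit content (`p ∤ L`, `g ∣ L` ⟹ `p ∤ g`).
[cite: GreenbergVatsal2000, p. 2, (2)] -/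
theorem hasUnitContent_of_dvd {g L : IwasawaAlgebra p} (h : g ∣ L) (hL : HasUnitContent L) :
    HasUnitContent g := by
  rw [hasUnitContent_iff_not_C_dvd] at hL ⊢
  exact fun hg ↦ hL (hg.trans h)

/-- `μ` is invariant under multiplication by a unit. [folklore] -/
theorem mu_mul_unit {g : IwasawaAlgebra p} (hg : g ≠ 0) (u : (IwasawaAlgebra p)ˣ) :
    mu (g * (u : IwasawaAlgebra p)) = mu g := by
  have hu := (isUnit_iff_mu_eq_zero_and_lam_eq_zero (u : IwasawaAlgebra p)).mp u.isUnit
  rw [mu_mul hg hu.1, hu.2.1, add_zero]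

/-- `λ` is invariant under multiplication by a unit. [folklore] -/
theorem lam_mul_unit {g : IwasawaAlgebra p} (hg : g ≠ 0) (u : (IwasawaAlgebra p)ˣ) :
    lam (g * (u : IwasawaAlgebra p)) = lam g := by
  have hu := (isUnit_iff_mu_eq_zero_and_lam_eq_zero (u : IwasawaAlgebra p)).mp u.isUnit
  rw [lam_mul hg hu.1, hu.2.2, add_zero]

/-- Generators of the same principal ideal have the same `μ` and `λ`. [folklore] -/
theorem mu_eq_and_lam_eq_of_span_eq {g g' : IwasawaAlgebra p} (hg : g ≠ 0)
    (h : Ideal.span ({g} : Set (IwasawaAlgebra p)) = Ideal.span {g'}) : mu g = mu g' ∧ lam g = lam g' := by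
  obtain ⟨u, hu⟩ := Ideal.span_singleton_eq_span_singleton.mp h
  rw [← hu, mu_mul_unit hg, lam_mul_unit hg]
  exact ⟨rfl, rfl⟩

/-- **`μ` across the sign-blind factorisation**: if `(ξ·δ) = (L)` with `L ≠ 0` and `δ` of unit content, then
`μ(ξ) = μ(L)` and `λ(ξ) + λ(δ) = λ(L)`. [cite: GreenbergVatsal2000, p. 2, (1)–(2)] [cite: Washington1997, §7.1] -/
theorem mu_eq_and_lam_add_eq_of_span_mul_eq_span {ξ δ L : IwasawaAlgebra p} (hL : L ≠ 0)
    (hδ : HasUnitContent δ) (h : Ideal.span ({ξ * δ} : Set (IwasawaAlgebra p)) = Ideal.span {L}) :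
    mu ξ = mu L ∧ lam ξ + lam δ = lam L := by
  have hξδ : ξ * δ ≠ 0 := by
    intro h0
    rw [h0, Ideal.span_singleton_eq_span_singleton] at h
    exact hL (zero_dvd_iff.mp h.dvd)
  have hξ : ξ ≠ 0 := left_ne_zero_of_mul hξδ
  have hδ0 : δ ≠ 0 := right_ne_zero_of_mul hξδ
  obtain ⟨hmu, hlam⟩ := mu_eq_and_lam_eq_of_span_eq hξδ h
  rw [mu_mul hξ hδ0, mu_eq_zero_of_hasUnitContent hδ, add_zero] at hmu
  rw [lam_mul hξ hδ0] at hlam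
  exact ⟨hmu, hlam⟩

/-- Under `(ξ·δ) = (L)` with `L ≠ 0` and `μ(δ) = 0`: `(ξ) = (L)` iff `λ(ξ) = λ(L)` iff `λ(δ) = 0`.
[cite: GreenbergVatsal2000, p. 4 (after Thm. (1.2))] -/
theorem span_eq_iff_lam_eq_of_span_mul_eq_span {ξ δ L : IwasawaAlgebra p} (hL : L ≠ 0)
    (hδ : HasUnitContent δ) (h : Ideal.span ({ξ * δ} : Set (IwasawaAlgebra p)) = Ideal.span {L}) :
    (Ideal.span ({ξ} : Set (IwasawaAlgebra p)) = Ideal.span {L} ↔ lam ξ = lam L) ∧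
      (lam ξ = lam L ↔ lam δ = 0) := by
  have hξδ : ξ * δ ≠ 0 := by
    intro h0
    rw [h0, Ideal.span_singleton_eq_span_singleton] at h
    exact hL (zero_dvd_iff.mp h.dvd)
  have hξ : ξ ≠ 0 := left_ne_zero_of_mul hξδ
  have hδ0 : δ ≠ 0 := right_ne_zero_of_mul hξδ
  obtain ⟨hmu, hlam⟩ := mu_eq_and_lam_add_eq_of_span_mul_eq_span hL hδ h
  have h2 : lam ξ = lam L ↔ lam δ = 0 := by omega
  refine ⟨?_, h2⟩
  constructor
  · intro hspan
    exact (mu_eq_and_lam_eq_of_span_eq hξ hspan).2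
  · intro hl
    -- `λ(δ) = 0` and `μ(δ) = 0` ⟹ `δ` is a unit ⟹ `(ξ) = (ξ δ) = (L)`
    have hδu : IsUnit δ :=
      (isUnit_iff_mu_eq_zero_and_lam_eq_zero δ).mpr ⟨hδ0, mu_eq_zero_of_hasUnitContent hδ, h2.mp hl⟩
    rw [← h]
    exact Ideal.span_singleton_eq_span_singleton.mpr (associated_mul_unit_right ξ δ hδu)

end Algebra

/-! ## §2 `min(μ(L_p⁺), μ(L_p⁻)) = 0`: common divisors of a Pollack pair have unit content (no image hypothesis) -/

section MinMu

variable {W : WeierstrassCurve ℚ} [W.IsElliptic] [W.IsGloballyMinimal] {p : ℕ} [Fact p.Prime]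

/-- From a sign `ε` with `μ(kobayashiL ε L⁺ L⁻) = 0`: every common divisor of `L⁺` and `L⁻` has unit content
(`kobayashiL ε` is one of the two). [cite: Kobayashi2003, Thm. 3.2 (p. 7)] -/
theorem hasUnitContent_of_dvd_of_dvd_of_sign {Lplus Lminus d : IwasawaAlgebra p} {ε : ℤˣ}
    (hε : HasUnitContent (kobayashiL ε Lplus Lminus)) (hp : d ∣ Lplus) (hm : d ∣ Lminus) :
    HasUnitContent d := by
  rcases Int.units_eq_one_or ε with rfl | rfl
  · have h1 : kobayashiL (1 : ℤˣ) Lplus Lminus = Lminus := by simp [kobayashiL]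
    rw [h1] at hε
    exact hasUnitContent_of_dvd hm hε
  · have h1 : kobayashiL (-1 : ℤˣ) Lplus Lminus = Lplus := by
      have hne : (-1 : ℤˣ) ≠ 1 := by decide
      simp [kobayashiL, hne]
    rw [h1] at hε
    exact hasUnitContent_of_dvd hp hε

/-- **`p = 3`, INPUT-FREE: every common divisor of Pollack's pair `(L₃⁺(f), L₃⁻(f))` has unit content** — for `W/ℚ`
globally minimal with good reduction at `3`, `a₃ = 0`, its newform `f` (conductor level) and any Pollack pair.  NO image
hypothesis (THEOREM B needs only `E[3]` irreducible, automatic at a supersingular prime).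
[cite: PollackWeston2011, Thm. 4.1 (1), Rem. 4.2] [cite: Vaserstein1972SL2, Theorem] -/
theorem hasUnitContent_of_dvd_of_dvd_three [NeZero (W.conductorNorm ℤ)]
    {f : CuspForm (Gamma0 (W.conductorNorm ℤ)) 2} (hf : IsNewformOf W f)
    (hgood : W.HasGoodReductionAtPrime 3) (hap : W.frobeniusTrace 3 = 0)
    {Lplus Lminus : IwasawaAlgebra 3} (hPP : IsPollackPair f 3 Lplus Lminus)
    {d : IwasawaAlgebra 3} (hp : d ∣ Lplus) (hm : d ∣ Lminus) : HasUnitContent d := by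
  obtain ⟨ε, hε⟩ := exists_sign_hasUnitContent_kobayashiL_three f hf hgood hap
  exact hasUnitContent_of_dvd_of_dvd_of_sign (hε Lplus Lminus hPP) hp hm

/-- **Odd `p` (B⁰ at `p ≥ 5`): every common divisor of Pollack's pair has unit content** — for `W/ℚ` globally minimal
with good reduction at the odd prime `p`, `a_p = 0`, its newform `f` and any Pollack pair; GRANTED Conjecture B⁰
`TeichSpanGenAll` (used only when `p ≥ 5`).  NO image hypothesis.
[cite: PollackWeston2011, Thm. 4.1 (1), Rem. 4.2] [cite: Vaserstein1972SL2, Theorem] [cite: MazurTateTeitelbaum1986Invent, §I.10 (10.1)] -/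
theorem hasUnitContent_of_dvd_of_dvd (hB : TeichSpanGenAll) (hp2 : p ≠ 2) [NeZero (W.conductorNorm ℤ)]
    {f : CuspForm (Gamma0 (W.conductorNorm ℤ)) 2} (hf : IsNewformOf W f)
    (hgood : W.HasGoodReductionAtPrime p) (hap : W.frobeniusTrace p = 0)
    {Lplus Lminus : IwasawaAlgebra p} (hPP : IsPollackPair f p Lplus Lminus)
    {d : IwasawaAlgebra p} (hp : d ∣ Lplus) (hm : d ∣ Lminus) : HasUnitContent d := by
  obtain ⟨ε, hε⟩ :=
    LargeImageMuFloor.signedMuFloor_of_teichSpanGenAll (W := W) hB hp2 hgood hap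
  exact hasUnitContent_of_dvd_of_dvd_of_sign (hε f hf Lplus Lminus hPP) hp hm

/-- **`min(μ(L_p⁺), μ(L_p⁻)) = 0`** in the form «`p` does not divide both»: for an odd good supersingular prime
(`a_p = 0`), the newform and any Pollack pair, `¬ (p ∣ L⁺ ∧ p ∣ L⁻)` — GRANTED B⁰ when `p ≥ 5`, input-free at `3`.
This is the `d = p` case of Kurihara–Pollack's Problem 3.2 / the μ-content of stub S2 of line `commonzero_squeeze`.
[cite: KuriharaPollack2007, §3.2 Problem 3.2] [cite: PollackWeston2011, Rem. 4.2] -/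
theorem not_C_dvd_and_C_dvd (hB : TeichSpanGenAll) (hp2 : p ≠ 2) [NeZero (W.conductorNorm ℤ)]
    {f : CuspForm (Gamma0 (W.conductorNorm ℤ)) 2} (hf : IsNewformOf W f)
    (hgood : W.HasGoodReductionAtPrime p) (hap : W.frobeniusTrace p = 0)
    {Lplus Lminus : IwasawaAlgebra p} (hPP : IsPollackPair f p Lplus Lminus) :
    ¬ (PowerSeries.C (p : ℤ_[p]) ∣ Lplus ∧ PowerSeries.C (p : ℤ_[p]) ∣ Lminus) := by
  rintro ⟨hp, hm⟩
  have h := hasUnitContent_of_dvd_of_dvd hB hp2 hf hgood hap hPP hp hm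
  rw [hasUnitContent_iff_not_C_dvd] at h
  exact h (dvd_refl _)

/-- **`min(μ(L_p⁺), μ(L_p⁻)) = 0`** with the tree's `μ` of an element of `Λ` (`X1.MuLambda.mu`): for an odd good
supersingular prime (`a_p = 0`), the newform and any Pollack pair, `μ(L⁺) = 0 ∨ μ(L⁻) = 0` — GRANTED B⁰ when `p ≥ 5`,
input-free at `3`. [cite: PollackWeston2011, Thm. 4.1 (1), Rem. 4.2] [cite: GreenbergVatsal2000, p. 2, (2)] -/
theorem mu_eq_zero_or_mu_eq_zero (hB : TeichSpanGenAll) (hp2 : p ≠ 2) [NeZero (W.conductorNorm ℤ)]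
    {f : CuspForm (Gamma0 (W.conductorNorm ℤ)) 2} (hf : IsNewformOf W f)
    (hgood : W.HasGoodReductionAtPrime p) (hap : W.frobeniusTrace p = 0)
    {Lplus Lminus : IwasawaAlgebra p} (hPP : IsPollackPair f p Lplus Lminus) :
    mu Lplus = 0 ∨ mu Lminus = 0 := by
  obtain ⟨ε, hε⟩ :=
    LargeImageMuFloor.signedMuFloor_of_teichSpanGenAll (W := W) hB hp2 hgood hap
  have h := hε f hf Lplus Lminus hPP
  rcases Int.units_eq_one_or ε with rfl | rfl
  · right
    have h1 : kobayashiL (1 : ℤˣ) Lplus Lminus = Lminus := by simp [kobayashiL]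
    exact mu_eq_zero_of_hasUnitContent (h1 ▸ h)
  · left
    have h1 : kobayashiL (-1 : ℤˣ) Lplus Lminus = Lplus := by
      have hne : (-1 : ℤˣ) ≠ 1 := by decide
      simp [kobayashiL, hne]
    exact mu_eq_zero_of_hasUnitContent (h1 ▸ h)

/-- **Stub S2 of line `commonzero_squeeze` REDUCED to common divisors WITH unit content.**  The registered-shape body of
`CommonZeroSqueeze.stub_commonDivisorsCyclotomic` («on the crux's class, a common divisor of `L⁺, L⁻` prime to `T` and
to every `Φ_n(1+T)` is a unit», with the line's `cycPhi p n` = `Φ_{p^n}(1+T)` passed as a parameter `Φ` so that no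
definition is restated) follows from the SAME statement restricted to common divisors `d` with `HasUnitContent d`
(`μ(d) = 0`), GRANTED B⁰ (used only at `p ≥ 5`): the μ-content of S2 is discharged, what remains is the statement
that `L⁺` and `L⁻` have no common NON-cyclotomic zero in the open unit disc (a distinguished-polynomial statement).
[cite: KuriharaPollack2007, §3.2 Problem 3.2, Prop. 3.3] [cite: PollackWeston2011, Rem. 4.2] -/
theorem commonDivisorsCyclotomic_of_unitContent (hB : TeichSpanGenAll)
    (Φ : (p : ℕ) → [Fact p.Prime] → ℕ → IwasawaAlgebra p)
    (hS2' : ∀ (W : WeierstrassCurve ℚ) [W.IsElliptic] [W.IsGloballyMinimal] (p : ℕ) [Fact p.Prime],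
      p ≠ 2 → ClassX7 W p → ¬ W.HasCM → W.frobeniusTrace p = 0 → Surj W p →
      ∀ [NeZero (W.conductorNorm ℤ)] (f : CuspForm (Gamma0 (W.conductorNorm ℤ)) 2), IsNewformOf W f →
      ∀ (Lplus Lminus : IwasawaAlgebra p), IsPollackPair f p Lplus Lminus →
      ∀ d : IwasawaAlgebra p, HasUnitContent d → d ∣ Lplus → d ∣ Lminus →
        ¬ (PowerSeries.X : IwasawaAlgebra p) ∣ d → (∀ n : ℕ, 1 ≤ n → ¬ Φ p n ∣ d) → IsUnit d) :
    ∀ (W : WeierstrassCurve ℚ) [W.IsElliptic] [W.IsGloballyMinimal] (p : ℕ) [Fact p.Prime],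
      p ≠ 2 → ClassX7 W p → ¬ W.HasCM → W.frobeniusTrace p = 0 → Surj W p →
      ∀ [NeZero (W.conductorNorm ℤ)] (f : CuspForm (Gamma0 (W.conductorNorm ℤ)) 2), IsNewformOf W f →
      ∀ (Lplus Lminus : IwasawaAlgebra p), IsPollackPair f p Lplus Lminus →
      ∀ d : IwasawaAlgebra p, d ∣ Lplus → d ∣ Lminus →
        ¬ (PowerSeries.X : IwasawaAlgebra p) ∣ d → (∀ n : ℕ, 1 ≤ n → ¬ Φ p n ∣ d) → IsUnit d := by
  intro W _ _ p _ hp2 hX hCM hap hS _ f hf Lplus Lminus hPP d hdp hdm hT hΦ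
  exact hS2' W p hp2 hX hCM hap hS f hf Lplus Lminus hPP d
    (hasUnitContent_of_dvd_of_dvd hB hp2 hf hX.1.1 hap hPP hdp hdm) hdp hdm hT hΦ

end MinMu

end Summit.BirchSwinnertonDyer.BirchSwinnertonDyer.Theorems.LargeImageMuPart

end
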